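import Summits.QuantumFields.BalabanUV.Beta.EriceRemainderEnclosureHistoryRenewalWitnessRuns
import Summits.QuantumFields.BalabanUV.Beta.EriceRemainderEnclosureHistoryRenewalStretched

/-!
# EriceRemainderEnclosureHistoryRenewalWitnessRate — (E35c) THE β-LEVEL CELL OF THE RATE ROW: NO GEOMETRIC TWO-RUN MATCHING RATE
# WITHOUT `FadingMemory` — for ALL class constants and EVERY `C`, `κ < 1` an admissible family and two pinned runs with
# `disc_j > C·κ^j`; with (E33g) by name: the rate of the class is stretched-exponential and not geometric, AT THE β LEVEL

Cell `pub-balaban`, β-function sub-cell, BINDER row D4 «RemainderConst leaves for Bałaban's split» (`HOME/BINDER-OWNERS.md`; owner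
lineage `b2b-balaban-beta-an4`; this file by co-owner #2 lineage `b2b-balaban-beta-d4-p2`, generation 37), β-FLOW TEAM duty (1),
FREEZE (0) honoured (def-free; no new leaf, no new hypothesis shape).  Part 3 of station (E35) over part 2
`EriceRemainderEnclosureHistoryRenewalWitnessRuns` (`witness_core`) and (E33g) `EriceRemainderEnclosureHistoryRenewalStretched`
(`disc_le_sqrt_uniform_sign`, by name in §4).

HONEST FRAMING (page 1, verbatim and binding).  *"Discharging BetaPertH makes Bałaban's UV stability UNCONDITIONAL — a real
constructive-QFT result; it is NOT the continuum limit and NOT the Clay problem."*  THIS FILE DISCHARGES NOTHING OF THE KIND.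
[folklore] real analysis: a WITNESS about the cell's own NOT-IN-PRINT binders (GAPS G-t4-U2-1∕-2), never an assertion about Bałaban's
(1.22).  Row D4 class UNCHANGED (critical-path width 0; instance 0∕1; D4 DISCHARGE NO DATE); NOT B12 Thm 2, NOT BetaPertH, NOT continuum,
NOT Clay.  HONEST DEPENDENCY: continuum YM on T⁴ ⇐ BetaPertH ∧ nine spine estimates (0/9 proved); BetaPertH ⇐ (D1) ∧ (D4) ∧ CAP+tail;
G-an2-4 gates asym, D1 and NE2/3/4.

THE POINT (census sense (α), the history channel's RATE row).  Gen 35 ((E33)) proved WITHOUT `FadingMemory`: existence of the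
continuum recursion variable, node U6's summability, and a K-uniform STRETCHED matching rate `L·ρ^⌊√j⌋` ((E33g)); gen 36 ((E34))
proved that through the ROW SYSTEM no geometric rate follows and recorded the β-level lower bound as OPEN («explicit pinned runs for an
adversarial non-Markov β out of reach; B^{(K)} = A^{(K+1)} kills explicit-run designs»).  THIS FILE CLOSES THAT CELL: §3
`not_geometric` — for ALL `c > 0`, `0 < θ < 1`, `γ > 0`, `b > 0`, `M > 0` and EVERY `C`, `0 ≤ κ < 1` there are `β`, `Λ`, `K`, two
pinned runs in the box and `j ≤ K` with the WHOLE binder list of (E33g) `disc_le_sqrt_uniform_sign` (k₀ = 0) and `C·κ^j < disc gA gB j`.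
The design needs only ONE pair of cutoffs per target, so the obstruction does not bite (part 1's header).  STAGED PATTERN (§1): `s + 1`
stages, ages `a_t = 2st + s + 1`, rows `k_t = s·t(t+1) + (s+1)t + s` (so `K = k_s + 1`, `j = k_s ≥ s³`), amplitudes
`ε_t = cθ^{a_t−1}∕(s+1)` with constant ratio `θ^{2s}`: the row cost of part 2 is `≤ (1 + 1∕γ² + 3(b+c))³(c∕b+1)(s+1)^{10}θ^s` and
the discrepancy at `j = k_s` is `cθ^{2s²+s}∕(s+1)`, whereas `Cκ^{k_s} ≤ C(κ^s)^{s²} ≤ Cθ^{4s²} ≤ (C(s+1)θ^s)·θ^{2s²+s}∕(s+1)`; §2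
picks `s` with `κ^s ≤ θ⁴`, `C(s+1)θ^s < c`, cost `≤ M`, `cθ^s ≤ b` (all eventually true: `(s+1)^p θ^s → 0`).  §4 `betaLevel_shape`
puts (E33g) and §3 side by side for the row budget `M = ρ²∕(γ³ + 2γ∕b)`: ONE `L` with `disc ≤ L·ρ^⌊√j⌋` over the class, and for every
`C`, `κ < 1` a member of the same class above `C·κ^j` — STRETCHED, NOT GEOMETRIC, at the β level.  RATE OF THE WITNESS: `ln(1∕disc_j)
≍ 2|ln θ|·j^{2∕3}` along `j = k_s` (envelope exponent `2∕3`; (E33g)'s `½` from above; the gap between the two exponents is left to a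
successor file).  HONEST: each witness has finitely many live ages, hence SOME fading modulus of its own, with a constant growing like
`θ^{−a_s}` — what fails is UNIFORMITY over the class: node U2's `disc_le_of_fadingMemory` needs its smallness `C_Λ·U ≤ (1−θ)∕2` on the
FADING constant `C_Λ`, which no row budget `M` controls; so the decay hypothesis (or an input beyond rows + NE4 as typed) is
LOAD-BEARING for the geometric SHAPE `InjectedRate C 0 θ`, while existence ∕ summability ∕ the stretched shape are not ((E33)).
`BetaFlowAsPrinted S` records a Markov β_n only ⇒ no junction of the as-printed interface changes.

WHAT IS PROVED (0 `def`, 0 sorry; [folklore]).  §1 `staged_first_factor_le`, `staged_second_factor_le`, `staged_cost_le`; §2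
`tendsto_succ_pow_mul_pow`, `exists_stages`; §3 `not_geometric`; §4 `betaLevel_shape` ((E33g) by name).
-/

noncomputable section
open Finset Filter Topology

namespace Summit.QuantumFields.BalabanUV.Beta.EriceRemainderEnclosureHistoryRenewalWitnessRate

open Literature.MathematicalPhysics.QuantumFieldTheory.Balaban1983to89
open Literature.MathematicalPhysics.QuantumFieldTheory.Balaban1983to89.FlowStep
open Literature.MathematicalPhysics.QuantumFieldTheory.Balaban1983to89.T4CouplingMatching
open Summit.QuantumFields.BalabanUV.Beta.EriceRemainderEnclosureHistoryRenewalWitnessRuns (witness_core)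
open Summit.QuantumFields.BalabanUV.Beta.EriceRemainderEnclosureHistoryRenewalStretched (disc_le_sqrt_uniform_sign)

/-! ## §1 The staged pattern: `s + 1` stages, ages `a_t = 2st + s + 1`, rows `k_t = s·t(t+1) + (s+1)t + s` -/

/-- First factor of the stage cost: `(1 + 1∕γ² + (b+c)(k_s+2))³ ≤ (1 + 1∕γ² + 3(b+c))³·(s+1)⁹`. [folklore] -/
theorem staged_first_factor_le {c γ b : ℝ} (hc : 0 < c) (hγ : 0 < γ) (hb : 0 < b) (s : ℕ)
    {k : ℕ → ℕ} (hk : ∀ t, k t = s * t * (t + 1) + (s + 1) * t + s) :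
    (1 + (1 / γ ^ 2 + (b + c) * (k s + 2))) ^ 3 ≤ (1 + 1 / γ ^ 2 + 3 * (b + c)) ^ 3 * ((s : ℝ) + 1) ^ 9 := by
  have hx : (0 : ℝ) ≤ (s : ℝ) := Nat.cast_nonneg s
  have hP1 : (1 : ℝ) ≤ ((s : ℝ) + 1) ^ 3 := one_le_pow₀ (by linarith)
  have hk2 : ((k s : ℕ) : ℝ) + 2 ≤ 3 * ((s : ℝ) + 1) ^ 3 := by
    rw [hk]; push_cast
    nlinarith [mul_nonneg (mul_nonneg hx hx) hx, mul_nonneg hx hx]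
  have hG0 : (0 : ℝ) ≤ 1 / γ ^ 2 := by positivity
  have hF : 1 + (1 / γ ^ 2 + (b + c) * (k s + 2)) ≤ (1 + 1 / γ ^ 2 + 3 * (b + c)) * ((s : ℝ) + 1) ^ 3 := by
    have h3 : (b + c) * ((k s : ℝ) + 2) ≤ (b + c) * (3 * ((s : ℝ) + 1) ^ 3) :=
      mul_le_mul_of_nonneg_left hk2 (by positivity)
    have h4 : (1 + 1 / γ ^ 2) ≤ (1 + 1 / γ ^ 2) * ((s : ℝ) + 1) ^ 3 := le_mul_of_one_le_right (by positivity) hP1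
    have e : (1 + 1 / γ ^ 2 + 3 * (b + c)) * ((s : ℝ) + 1) ^ 3
        = (1 + 1 / γ ^ 2) * ((s : ℝ) + 1) ^ 3 + (b + c) * (3 * ((s : ℝ) + 1) ^ 3) := by ring
    linarith
  have hF0 : 0 ≤ 1 + (1 / γ ^ 2 + (b + c) * (k s + 2)) := by positivity
  calc (1 + (1 / γ ^ 2 + (b + c) * (k s + 2))) ^ 3 ≤ ((1 + 1 / γ ^ 2 + 3 * (b + c)) * ((s : ℝ) + 1) ^ 3) ^ 3 :=
        pow_le_pow_left₀ hF0 hF 3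
    _ = (1 + 1 / γ ^ 2 + 3 * (b + c)) ^ 3 * ((s : ℝ) + 1) ^ 9 := by rw [mul_pow, ← pow_mul]

/-- Second factor of the stage cost: with `a_t = 2st + s + 1` every ratio `θ^{a_{t+1}−1}∕θ^{a_t−1}` is `θ^{2s}`, so
`cθ^{a_0−1}∕((s+1)b) + Σ_{t<s} θ^{a_{t+1}−1}∕θ^{a_t−1} ≤ (c∕b + 1)(s+1)θ^s`. [folklore] -/
theorem staged_second_factor_le {c θ b : ℝ} (hc : 0 < c) (hθ0 : 0 < θ) (hθ1 : θ ≤ 1) (hb : 0 < b) (s : ℕ)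
    {a : ℕ → ℕ} (ha : ∀ t, a t = 2 * s * t + s + 1) :
    c * θ ^ (a 0 - 1) / (s + 1) / b + ∑ t ∈ range s, θ ^ (a (t + 1) - 1) / θ ^ (a t - 1)
      ≤ (c / b + 1) * ((s : ℝ) + 1) * θ ^ s := by
  have hx : (0 : ℝ) ≤ (s : ℝ) := Nat.cast_nonneg s
  have hθs : θ ^ s ≤ 1 := pow_le_one₀ hθ0.le hθ1
  have ha0 : a 0 - 1 = s := by rw [ha]; omega
  have hrat : ∀ t, θ ^ (a (t + 1) - 1) / θ ^ (a t - 1) = θ ^ (2 * s) := fun t => by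
    rw [div_eq_iff (pow_ne_zero _ hθ0.ne'), ← pow_add]
    congr 1; rw [ha, ha]; ring_nf; omega
  rw [ha0, sum_congr rfl fun t _ => hrat t, sum_const, card_range, nsmul_eq_mul]
  have h1 : c * θ ^ s / (s + 1) / b ≤ c / b * θ ^ s := by
    rw [div_div, div_le_iff₀ (by positivity)]
    have e : c / b * θ ^ s * ((↑s + 1) * b) = c * θ ^ s * (s + 1) := by field_simp
    rw [e]
    nlinarith [mul_nonneg (mul_nonneg hc.le (pow_nonneg hθ0.le s)) hx]
  have h2 : (s : ℝ) * θ ^ (2 * s) ≤ ((s : ℝ) + 1) * θ ^ s := by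
    have h3 : θ ^ (2 * s) ≤ θ ^ s := by
      rw [two_mul, pow_add]; exact mul_le_of_le_one_left (pow_nonneg hθ0.le s) hθs
    nlinarith [pow_pos hθ0 s, pow_nonneg hθ0.le (2 * s)]
  have h4 : 0 ≤ c / b * θ ^ s * s := by positivity
  have e : (c / b + 1) * (↑s + 1) * θ ^ s = c / b * θ ^ s + (↑s + 1) * θ ^ s + c / b * θ ^ s * s := by ring
  linarith

/-- The stage cost of the staged pattern is at most `(1 + 1∕γ² + 3(b+c))³·(c∕b + 1)·(s+1)^{10}·θ^s`. [folklore] -/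
theorem staged_cost_le {c θ γ b : ℝ} (hc : 0 < c) (hθ0 : 0 < θ) (hθ1 : θ ≤ 1) (hγ : 0 < γ) (hb : 0 < b) (s : ℕ)
    {a k : ℕ → ℕ} (ha : ∀ t, a t = 2 * s * t + s + 1) (hk : ∀ t, k t = s * t * (t + 1) + (s + 1) * t + s) :
    (1 + (1 / γ ^ 2 + (b + c) * (k s + 2))) ^ 3 *
        (c * θ ^ (a 0 - 1) / (s + 1) / b + ∑ t ∈ range s, θ ^ (a (t + 1) - 1) / θ ^ (a t - 1))
      ≤ (1 + 1 / γ ^ 2 + 3 * (b + c)) ^ 3 * (c / b + 1) * ((s : ℝ) + 1) ^ 10 * θ ^ s := by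
  have hG0 : 0 ≤ c * θ ^ (a 0 - 1) / (s + 1) / b + ∑ t ∈ range s, θ ^ (a (t + 1) - 1) / θ ^ (a t - 1) :=
    add_nonneg (div_nonneg (div_nonneg (mul_nonneg hc.le (pow_nonneg hθ0.le _)) (by positivity)) hb.le)
      (sum_nonneg fun t _ => div_nonneg (pow_nonneg hθ0.le _) (pow_nonneg hθ0.le _))
  have hR0 : 0 ≤ (1 + 1 / γ ^ 2 + 3 * (b + c)) ^ 3 * ((s : ℝ) + 1) ^ 9 :=
    mul_nonneg (pow_nonneg (by positivity) 3) (pow_nonneg (by positivity) 9)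
  refine (mul_le_mul (staged_first_factor_le hc hγ hb s hk) (staged_second_factor_le hc hθ0 hθ1 hb s ha) hG0 hR0).trans
    (le_of_eq ?_)
  rw [show ((s : ℝ) + 1) ^ 10 = ((s : ℝ) + 1) ^ 9 * ((s : ℝ) + 1) from pow_succ _ 9]
  ring

/-! ## §2 Choosing the number of stages -/

/-- `(s+1)^p·θ^s → 0` for `0 < θ < 1`. [folklore] -/
theorem tendsto_succ_pow_mul_pow {θ : ℝ} (hθ0 : 0 < θ) (hθ1 : θ < 1) (p : ℕ) :
    Tendsto (fun s : ℕ => ((s : ℝ) + 1) ^ p * θ ^ s) atTop (𝓝 0) := by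
  have hθabs : |θ| < 1 := by rwa [abs_of_pos hθ0]
  have h := ((tendsto_pow_const_mul_const_pow_of_abs_lt_one p hθabs).comp (tendsto_add_atTop_nat 1)).const_mul θ⁻¹
  rw [mul_zero] at h
  refine h.congr fun s => ?_
  simp only [Function.comp_apply]
  push_cast
  rw [pow_succ]; field_simp

/-- For every `κ < 1` and all targets there is a number of stages `s` with `κ^s ≤ θ⁴`, `C(s+1)θ^s < c`, `A(s+1)^{10}θ^s ≤ M` and
`cθ^s ≤ b`. [folklore] -/
theorem exists_stages {c θ b M A C κ : ℝ} (hc : 0 < c) (hθ0 : 0 < θ) (hθ1 : θ < 1) (hb : 0 < b) (hM : 0 < M)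
    (hκ0 : 0 ≤ κ) (hκ1 : κ < 1) :
    ∃ s : ℕ, κ ^ s ≤ θ ^ 4 ∧ C * ((s : ℝ) + 1) * θ ^ s < c ∧ A * ((s : ℝ) + 1) ^ 10 * θ ^ s ≤ M ∧ c * θ ^ s ≤ b := by
  have e1 : ∀ᶠ s : ℕ in atTop, κ ^ s ≤ θ ^ 4 :=
    (tendsto_pow_atTop_nhds_zero_of_lt_one hκ0 hκ1).eventually (eventually_le_nhds (pow_pos hθ0 4))
  have e2 : ∀ᶠ s : ℕ in atTop, C * ((s : ℝ) + 1) * θ ^ s < c := by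
    have h := (tendsto_succ_pow_mul_pow hθ0 hθ1 1).const_mul C
    rw [mul_zero] at h
    refine (h.eventually (eventually_lt_nhds hc)).mono fun s hs => ?_
    simpa [pow_one, mul_assoc] using hs
  have e3 : ∀ᶠ s : ℕ in atTop, A * ((s : ℝ) + 1) ^ 10 * θ ^ s ≤ M := by
    have h := (tendsto_succ_pow_mul_pow hθ0 hθ1 10).const_mul A
    rw [mul_zero] at h
    refine (h.eventually (eventually_le_nhds hM)).mono fun s hs => ?_
    simpa [mul_assoc] using hs
  have e4 : ∀ᶠ s : ℕ in atTop, c * θ ^ s ≤ b := by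
    have h := (tendsto_pow_atTop_nhds_zero_of_lt_one hθ0.le hθ1).const_mul c
    rw [mul_zero] at h
    exact h.eventually (eventually_le_nhds hb)
  exact (e1.and (e2.and (e3.and e4))).exists

/-! ## §3 The β-level cell: no geometric two-run matching rate without fading memory -/

/-- **NO GEOMETRIC TWO-RUN MATCHING RATE AT THE β LEVEL WITHOUT `FadingMemory` (E35).**  For ALL class constants — NE4's `c > 0` and
`0 < θ < 1`, the box `γ > 0`, the asymptotic-freedom floor `b > 0`, and ANY row budget `M > 0` for the history moduli — and for EVERY
`C` and `κ < 1`, there are a history family `β`, moduli `Λ`, a cutoff `K`, two runs `gA` (K steps) and `gB` (K + 1 steps) of (0.20)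
and a scale `j ≤ K` satisfying EVERY binder of (E33g) `disc_le_sqrt_uniform_sign` — `RGEqH`, boxes, pin, `ScaleShiftRate c θ γ β`,
`HistLipschitz Λ γ β` with `Λ ≥ 0` and rows `≤ M`, `BetaLowerH 0 γ β`, `EventualLowerH b γ 0 β` — with `disc gA gB j > C·κ^j`.
So the stretched-exponential shape of (E33c)∕(E33f)∕(E33g) cannot be improved to node U2's geometric `InjectedRate C 0 κ` at the
β LEVEL: the binder list of station (E33) does not carry a geometric rate, and the method-level verdict of (E34) (no geometric rate
THROUGH THE ROW SYSTEM) is realized by an admissible family.  WITNESS (§1, `witness_core`): the digital stationary additive family with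
`s + 1` stages — `β_{k+1} = B₀ − Σ_t [a_t ≤ k]·ε_t·tent_t(g_{k−a_t})`, ages `a_t = 2st + s + 1`, amplitudes `ε_t = cθ^{a_t−1}∕(s+1)`,
run A the grid `x⋆ + B₀·n`, run B firing stage `t` at row `k_t + 1` (`k_t = s·t(t+1) + (s+1)t + s`), seeded at run B's bare
coupling — at `j = k_s ≥ s³`: `disc = cθ^{2s²+s}∕(s+1)`, beating `Cκ^j ≤ C(θ⁴)^{s²}` once `κ^s ≤ θ⁴` and `C(s+1)θ^s < c`; the row budget
is met by `(1 + 1∕γ² + 3(b+c))³(c∕b+1)(s+1)^{10}θ^s ≤ M`.  HONEST: each witness has finitely many live ages, hence an (astronomically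
expensive) fading modulus of its own — what fails is UNIFORMITY over the class: node U2's `disc_le_of_fadingMemory` needs its smallness
`C_Λ·U ≤ (1−θ)∕2` on the FADING constant, which no row budget `M` controls.  Every hypothesis shape is an UNPRINTED input of the cell
(GAPS G-t4-U2-1∕-2); nothing of [I] (1.22) is asserted; NOT B12 Thm 2, NOT BetaPertH, NOT continuum, NOT Clay.
[cite: Balaban1987RG1, (0.20) p.256 and §5 p.298] -/
theorem not_geometric {c θ γ b M : ℝ} (hc : 0 < c) (hθ0 : 0 < θ) (hθ1 : θ < 1) (hγ : 0 < γ) (hb : 0 < b) (hM : 0 < M)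
    (C κ : ℝ) (hκ0 : 0 ≤ κ) (hκ1 : κ < 1) :
    ∃ (β : HBeta) (Λ : ℕ → ℕ → ℝ) (K : ℕ) (gA gB : ℕ → ℝ) (j : ℕ),
      RGEqH K β gA ∧ RGEqH (K + 1) β gB ∧
      (∀ i, i ≤ K → 0 < gA i ∧ gA i ≤ γ) ∧ (∀ i, i ≤ K + 1 → 0 < gB i ∧ gB i ≤ γ) ∧ gA K = gB (K + 1) ∧
      ScaleShiftRate c θ γ β ∧ HistLipschitz Λ γ β ∧ (∀ k i, i ≤ k → 0 ≤ Λ k i) ∧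
      (∀ k, ∑ i ∈ range (k + 1), Λ k i ≤ M) ∧ BetaLowerH 0 γ β ∧ EventualLowerH b γ 0 β ∧
      j ≤ K ∧ C * κ ^ j < disc gA gB j := by
  obtain ⟨s, h1, h2, h3, h4⟩ := exists_stages (A := (1 + 1 / γ ^ 2 + 3 * (b + c)) ^ 3 * (c / b + 1)) (C := C)
    hc hθ0 hθ1 hb hM hκ0 hκ1
  -- the staged pattern
  obtain ⟨a, ha⟩ : ∃ a : ℕ → ℕ, ∀ t, a t = 2 * s * t + s + 1 := ⟨_, fun _ => rfl⟩
  obtain ⟨k, hk⟩ : ∃ k : ℕ → ℕ, ∀ t, k t = s * t * (t + 1) + (s + 1) * t + s := ⟨_, fun _ => rfl⟩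
  have ha0 : a 0 = k 0 + 1 := by rw [ha, hk]; ring
  have hak : ∀ t, t < s → k (t + 1) = k t + a (t + 1) := fun t _ => by rw [hk, hk, ha]; ring
  have hεb : ∀ t, t ≤ s → c * θ ^ (a t - 1) / (s + 1) ≤ b := by
    intro t _
    have hst : s ≤ a t - 1 := by rw [ha, Nat.add_sub_cancel]; exact Nat.le_add_left s _
    have hle : c * θ ^ (a t - 1) ≤ c * θ ^ s := mul_le_mul_of_nonneg_left (pow_le_pow_of_le_one hθ0.le hθ1.le hst) hc.le
    have hd : c * θ ^ (a t - 1) / (s + 1) ≤ c * θ ^ (a t - 1) :=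
      div_le_self (by positivity) (by linarith [(Nat.cast_nonneg s : (0 : ℝ) ≤ s)])
    linarith
  obtain ⟨β, Λ, gA, gB, hRA, hRB, hAbox, hBbox, hpin, hSSR, hHL, hΛ0, hrows, hsign, hfloor, hdisc⟩ :=
    witness_core hc hθ0 hθ1.le hγ hb ha0 hak hεb
  refine ⟨β, Λ, k s + 1, gA, gB, k s, hRA, hRB, hAbox, hBbox, hpin, hSSR, hHL, hΛ0, fun kk => ?_, hsign, hfloor,
    Nat.le_succ _, ?_⟩
  · exact (hrows kk).trans ((staged_cost_le hc hθ0 hθ1.le hγ hb s ha hk).trans h3)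
  · refine lt_of_lt_of_le ?_ hdisc
    have has : a s - 1 = 2 * s * s + s := by rw [ha, Nat.add_sub_cancel]
    rw [has]
    have hpos : (0 : ℝ) < c * θ ^ (2 * s * s + s) / (s + 1) := by positivity
    rcases le_or_gt C 0 with hC | hC
    · exact lt_of_le_of_lt (mul_nonpos_of_nonpos_of_nonneg hC (pow_nonneg hκ0 _)) hpos
    · have hss : s ≤ s * s := Nat.le_mul_self s
      have hks3 : s * (s * s) ≤ k s := by rw [hk]; nlinarith [Nat.zero_le s, Nat.zero_le (s * s)]
      have hexp : s + (2 * s * s + s) ≤ 4 * (s * s) := by nlinarith [hss]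
      calc C * κ ^ k s ≤ C * κ ^ (s * (s * s)) := mul_le_mul_of_nonneg_left (pow_le_pow_of_le_one hκ0 hκ1.le hks3) hC.le
        _ = C * (κ ^ s) ^ (s * s) := by rw [pow_mul]
        _ ≤ C * (θ ^ 4) ^ (s * s) := mul_le_mul_of_nonneg_left (pow_le_pow_left₀ (pow_nonneg hκ0 s) h1 _) hC.le
        _ = C * θ ^ (4 * (s * s)) := by rw [← pow_mul]
        _ ≤ C * θ ^ (s + (2 * s * s + s)) := mul_le_mul_of_nonneg_left (pow_le_pow_of_le_one hθ0.le hθ1.le hexp) hC.le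
        _ = (C * ((s : ℝ) + 1) * θ ^ s) * (θ ^ (2 * s * s + s) / ((s : ℝ) + 1)) := by
            rw [pow_add]; field_simp
        _ < c * (θ ^ (2 * s * s + s) / ((s : ℝ) + 1)) := mul_lt_mul_of_pos_right h2 (by positivity)
        _ = c * θ ^ (2 * s * s + s) / (s + 1) := by ring

/-! ## §4 The rate row at the β level: stretched from above (E33g), not geometric from below (§3) — by name -/

/-- **THE β-LEVEL SHAPE OF THE RATE ROW — STRETCHED, NOT GEOMETRIC (sandwich, by name).**  For all `c > 0`, `0 < θ < ρ < 1`, box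
`γ > 0` and floor `b > 0`, take the row budget `M := ρ²∕(γ³ + 2γ∕b)` ((E33g)'s smallness against node U2's K-uniform AF weight sum,
`k₀ = 0`).  THEN (i) (E33g) `disc_le_sqrt_uniform_sign`: ONE `L` with `disc gA gB j ≤ L·ρ^⌊√j⌋` for EVERY family of the class (NE4 as
`ScaleShiftRate c θ γ`, `HistLipschitz` with rows `≤ M`, sign, floor `b`) and every pair of pinned runs, K-UNIFORMLY; (ii) §3
`not_geometric`: for every `C` and `κ < 1` some member of the SAME class and some `j ≤ K` have `disc gA gB j > C·κ^j`.  The two-run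
matching rate of the class is stretched-exponential and NOT geometric — at the β level, not only through the row system of (E34).
[cite: Balaban1987RG1, (0.20) p.256 and §5 p.298] -/
theorem betaLevel_shape {c θ ρ γ b : ℝ} (hc : 0 < c) (hθ0 : 0 < θ) (hθρ : θ < ρ) (hρ1 : ρ < 1) (hγ : 0 < γ) (hb : 0 < b) :
    ∃ M : ℝ, 0 < M ∧
      (∃ L : ℝ, 0 ≤ L ∧ ∀ (β : HBeta) (Λ : ℕ → ℕ → ℝ) (K : ℕ) (gA gB : ℕ → ℝ),
        RGEqH K β gA → RGEqH (K + 1) β gB →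
        (∀ i, i ≤ K → 0 < gA i ∧ gA i ≤ γ) → (∀ i, i ≤ K + 1 → 0 < gB i ∧ gB i ≤ γ) → gA K = gB (K + 1) →
        ScaleShiftRate c θ γ β → HistLipschitz Λ γ β → (∀ k i, i ≤ k → 0 ≤ Λ k i) →
        (∀ k, ∑ i ∈ range (k + 1), Λ k i ≤ M) → BetaLowerH 0 γ β → EventualLowerH b γ 0 β →
        ∀ j, j ≤ K → disc gA gB j ≤ L * ρ ^ Nat.sqrt j) ∧
      (∀ C κ : ℝ, 0 ≤ κ → κ < 1 → ∃ (β : HBeta) (Λ : ℕ → ℕ → ℝ) (K : ℕ) (gA gB : ℕ → ℝ) (j : ℕ),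
        RGEqH K β gA ∧ RGEqH (K + 1) β gB ∧
        (∀ i, i ≤ K → 0 < gA i ∧ gA i ≤ γ) ∧ (∀ i, i ≤ K + 1 → 0 < gB i ∧ gB i ≤ γ) ∧ gA K = gB (K + 1) ∧
        ScaleShiftRate c θ γ β ∧ HistLipschitz Λ γ β ∧ (∀ k i, i ≤ k → 0 ≤ Λ k i) ∧
        (∀ k, ∑ i ∈ range (k + 1), Λ k i ≤ M) ∧ BetaLowerH 0 γ β ∧ EventualLowerH b γ 0 β ∧
        j ≤ K ∧ C * κ ^ j < disc gA gB j) := by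
  have hU : 0 < (((0 : ℕ) : ℝ) + 1) * γ ^ 3 + 2 * γ / b := by positivity
  have hρ0 : 0 < ρ := hθ0.trans hθρ
  refine ⟨ρ ^ 2 / ((((0 : ℕ) : ℝ) + 1) * γ ^ 3 + 2 * γ / b), by positivity, ?_, fun C κ hκ0 hκ1 => ?_⟩
  · exact disc_le_sqrt_uniform_sign (k₀ := 0) hc.le hθ0.le hθρ hρ1 hγ hb (by positivity) (le_of_eq (div_mul_cancel₀ _ hU.ne'))
  · exact not_geometric hc hθ0 (hθρ.trans hρ1) hγ hb (by positivity) C κ hκ0 hκ1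

end Summit.QuantumFields.BalabanUV.Beta.EriceRemainderEnclosureHistoryRenewalWitnessRate

end
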